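import Summits.CriticalPhenomena.PercolationContinuityZ3.Theorems.SoloInformedBoxCrossingFace
import Literature.Probability.Percolation.StaticRenormalizationBoxes
import Literature.Probability.Percolation.HalfSpaceBGN
import HarnessLib

/-!
# Linking events, translated box crossings and the grid `(2L+1)ℤ^d` (solo seat
`solo-CriticalPhenomena-informed`, toolbox for `SoloInformedCrossingLowerBound`)

Infrastructure for the a-priori lower bound on the crossing probabilities of row (Y)
(`SoloInformedCrossingLowerBound`, paper §7b.3 (d5)):

* `linked S A B = {A ↔ B in S}` — a union of the events `inConn S a b` of the static
  renormalisation toolbox; measurable, determined by the edges inside `S`, continuous in `p` for a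
  finite box (`continuous_real_linked`), transported by lattice symmetries
  (`real_linked_image`); the box-crossing event of row (Y) is
  `boxCrossing d n N = {∂ⁱⁿΛ(N) ↔ Λ(n) in Λ(N)}` (`boxCrossing_eq_linked`), whence
  `continuous_real_boxCrossing` and `boxCrossing_mono_left`.
* `sbox v N = v + Λ(N)` and the translated crossing `sCross L v = {Λ_v(L) ↔ ∂ⁱⁿΛ_v(4L) in Λ_v(4L)}`,
  with `P_p(sCross L v) = P_p(boxCrossing d L (4L))` (`real_sCross`), independence of translates
  in disjoint boxes (`real_inter_sCross`), and the exit argument `mem_sCross_of_reachable`: an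
  open lattice path from a site of `Λ_v(L)` to a site outside `Λ_v(4L)` realises `sCross L v`.
* the grid `(2L+1)ℤ^d`: every site `u` lies in the block `Λ_{(2L+1)k}(L)` of its grid index
  `k = gridIdx L u` (`mem_sbox_gridPt`), and `gridIdx` maps `Λ(M)` into `Λ(K)` when
  `M + L < (K+1)(2L+1)` (`gridIdx_mem_box`).

All statements are elementary (Grimmett 1999, §1.6 translation invariance; §2 locality).
[folklore]
-/
noncomputable section

namespace Summit.CriticalPhenomena.PercolationContinuityZ3.Theorems

open MeasureTheory ProbabilityTheory Filter Topology
open Literature.Probability.Percolation Literature.Probability.LatticeModels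
open Literature.Probability.Percolation.CerfDembinVanishing
open scoped ENNReal

namespace SurfaceTension

variable {d : ℕ}

/-! ## Linking events `A ↔ B in S` -/

/-- `A ↔ B in S`: some site of `A` is joined to some site of `B` by an open lattice path inside
`S` (a union of the events `inConn S a b` of the static-renormalisation toolbox). -/
def linked (S A B : Set (Site d)) : Set (BondConfig (Site d)) :=
  ⋃ a ∈ A, ⋃ b ∈ B, inConn S a b

/-- Membership in `linked`, unfolded. -/
theorem mem_linked_iff {S A B : Set (Site d)} {ω : BondConfig (Site d)} :
    ω ∈ linked S A B ↔ ∃ a ∈ A, ∃ b ∈ B, ω ∈ inConn S a b := by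
  simp only [linked, Set.mem_iUnion, exists_prop]

/-- `linked` is monotone in the target set. -/
theorem linked_mono_right (S A : Set (Site d)) {B B' : Set (Site d)} (h : B ⊆ B') :
    linked S A B ⊆ linked S A B' := by
  intro ω hω
  rw [mem_linked_iff] at hω ⊢
  obtain ⟨a, ha, b, hb, hab⟩ := hω
  exact ⟨a, ha, b, h hb, hab⟩

/-- `linked` is measurable. -/
theorem measurableSet_linked (S A B : Set (Site d)) : MeasurableSet (linked S A B) :=
  MeasurableSet.biUnion A.to_countable fun a _ =>
    MeasurableSet.biUnion B.to_countable fun b _ => measurableSet_inConn S a b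

/-- `A ↔ B in S` only reads the edges inside `S`. -/
theorem determinedBy_linked (S A B : Set (Site d)) :
    DeterminedBy (linked S A B) (withinGraph (zdGraph d) S).edgeSet :=
  DeterminedBy.iUnion₂ fun a _ => DeterminedBy.iUnion₂ fun b _ => determinedBy_openConnVia _ a b

/-- For a finite box, `A ↔ B in Λ` is determined by the finitely many edges inside `Λ`. -/
theorem determinedBy_linked_edgesIn (Λ : Finset (Site d)) (A B : Set (Site d)) :
    DeterminedBy (linked (↑Λ) A B) ↑(edgesIn (zdGraph d) Λ) :=
  DeterminedBy.iUnion₂ fun a _ => DeterminedBy.iUnion₂ fun b _ => determinedBy_inConn Λ a b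

/-- `p ↦ P_p(A ↔ B in Λ)` is continuous for a finite box `Λ` (a polynomial in `p`). -/
theorem continuous_real_linked (Λ : Finset (Site d)) (A B : Set (Site d)) :
    Continuous fun p : unitInterval => (bondPercolation (zdGraph d) p).real (linked (↑Λ) A B) :=
  continuous_bondPercolation_real_of_determinedBy (zdGraph d) (determinedBy_linked_edgesIn Λ A B)

/-- Transport of `A ↔ B in S` along a lattice symmetry. -/
theorem preimage_relabel_linked (φ : zdGraph d ≃g zdGraph d) (S A B : Set (Site d)) :
    BondConfig.relabel (sym2Equiv φ.toEquiv) ⁻¹' linked (φ '' S) (φ '' A) (φ '' B) =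
      linked S A B := by
  ext ω
  simp only [Set.mem_preimage, mem_linked_iff]
  constructor
  · rintro ⟨_, ⟨a, ha, rfl⟩, _, ⟨b, hb, rfl⟩, h⟩
    exact ⟨a, ha, b, hb, (Set.ext_iff.1 (preimage_relabel_inConn φ S a b) ω).1 h⟩
  · rintro ⟨a, ha, b, hb, h⟩
    exact ⟨φ a, Set.mem_image_of_mem φ ha, φ b, Set.mem_image_of_mem φ hb,
      (Set.ext_iff.1 (preimage_relabel_inConn φ S a b) ω).2 h⟩

/-- `P_p(φA ↔ φB in φS) = P_p(A ↔ B in S)` for every symmetry `φ` of `ℤ^d`. -/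
theorem real_linked_image (φ : zdGraph d ≃g zdGraph d) (p : unitInterval) (S A B : Set (Site d)) :
    (bondPercolation (zdGraph d) p).real (linked (φ '' S) (φ '' A) (φ '' B)) =
      (bondPercolation (zdGraph d) p).real (linked S A B) := by
  rw [← bondPercolation_real_preimage_relabel_iso φ p, preimage_relabel_linked]

/-- The box-crossing event of row (Y) as a linking event:
`boxCrossing d n N = {∂ⁱⁿΛ(N) ↔ Λ(n) in Λ(N)}`. -/
theorem boxCrossing_eq_linked (n N : ℕ) :
    boxCrossing d n N =
      linked ↑(box d N) ↑(innerBoundary (zdGraph d) (box d N)) ↑(box d n) := by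
  ext ω
  simp only [boxCrossing, Set.mem_setOf_eq, mem_linked_iff, Finset.mem_coe]
  constructor
  · rintro ⟨v, hv⟩
    rw [mem_gate_iff, mem_linkedToBox_iff] at hv
    obtain ⟨hvb, x, hx, hxv⟩ := hv
    exact ⟨v, hvb, x, hx, hxv⟩
  · rintro ⟨v, hvb, x, hx, hxv⟩
    exact ⟨v, mem_gate_iff.2 ⟨hvb, mem_linkedToBox_iff.2 ⟨x, hx, hxv⟩⟩⟩

/-- `boxCrossing d n N` grows with the inner box. -/
theorem boxCrossing_mono_left {n n' : ℕ} (h : n ≤ n') (N : ℕ) :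
    boxCrossing d n N ⊆ boxCrossing d n' N := by
  rw [boxCrossing_eq_linked, boxCrossing_eq_linked]
  exact linked_mono_right _ _ (Finset.coe_subset.2 (box_mono d h))

/-- `p ↦ P_p(boxCrossing d n N)` is continuous. -/
theorem continuous_real_boxCrossing (n N : ℕ) :
    Continuous fun p : unitInterval => (bondPercolation (zdGraph d) p).real (boxCrossing d n N) := by
  simp only [boxCrossing_eq_linked]
  exact continuous_real_linked _ _ _

/-! ## Translated boxes and translated crossing events -/

/-- The translated box `Λ_v(N) = v + Λ(N)`. -/
def sbox (v : Site d) (N : ℕ) : Set (Site d) := (zdShiftIso v) '' ↑(box d N)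

/-- Membership in a translated box: every coordinate of `y - v` lies in `[-N, N]`. -/
theorem mem_sbox_iff {v : Site d} {N : ℕ} {y : Site d} :
    y ∈ sbox v N ↔ ∀ i, -(N : ℤ) ≤ y i - v i ∧ y i - v i ≤ N := by
  constructor
  · rintro ⟨x, hx, rfl⟩ i
    rw [Finset.mem_coe, mem_box] at hx
    simp only [zdShiftIso_apply, Pi.add_apply, add_sub_cancel_right]
    exact hx i
  · intro h
    refine ⟨y - v, ?_, by simp [zdShiftIso_apply]⟩
    rw [Finset.mem_coe, mem_box]
    intro i
    simpa only [Pi.sub_apply] using h i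

/-- Translated boxes are nested. -/
theorem sbox_mono (v : Site d) {N N' : ℕ} (h : N ≤ N') : sbox v N ⊆ sbox v N' :=
  Set.image_mono (Finset.coe_subset.2 (box_mono d h))

/-- The translate by `v` of the crossing event of row (Y) at scale `L`:
`Λ_v(L) ↔ ∂ⁱⁿΛ_v(4L) in Λ_v(4L)`. -/
def sCross (L : ℕ) (v : Site d) : Set (BondConfig (Site d)) :=
  linked (sbox v (4 * L)) ((zdShiftIso v) '' ↑(innerBoundary (zdGraph d) (box d (4 * L))))
    (sbox v L)

/-- Translates have the probability of the original: `P_p(sCross L v) = P_p(boxCrossing d L (4L))`. -/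
theorem real_sCross (p : unitInterval) (L : ℕ) (v : Site d) :
    (bondPercolation (zdGraph d) p).real (sCross L v) =
      (bondPercolation (zdGraph d) p).real (boxCrossing d L (4 * L)) := by
  rw [sCross, sbox, sbox, real_linked_image, boxCrossing_eq_linked]

/-- `sCross L v` is measurable. -/
theorem measurableSet_sCross (L : ℕ) (v : Site d) : MeasurableSet (sCross L v) :=
  measurableSet_linked _ _ _

/-- `sCross L v` only reads the edges inside `Λ_v(4L)`. -/
theorem determinedBy_sCross (L : ℕ) (v : Site d) :
    DeterminedBy (sCross L v) (withinGraph (zdGraph d) (sbox v (4 * L))).edgeSet :=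
  determinedBy_linked _ _ _

/-- Disjoint regions carry disjoint sets of interior edges. -/
theorem disjoint_edgeSet_withinGraph {R₁ R₂ : Set (Site d)} (h : Disjoint R₁ R₂) :
    Disjoint (withinGraph (zdGraph d) R₁).edgeSet (withinGraph (zdGraph d) R₂).edgeSet := by
  rw [Set.disjoint_left]
  intro e h₁ h₂
  induction e using Sym2.ind with
  | h u v =>
    rw [mem_edgeSet_withinGraph] at h₁ h₂
    exact Set.disjoint_left.1 h h₁.2.1 h₂.2.1

/-- **Independence of translated crossings in disjoint boxes.** -/
theorem real_inter_sCross (p : unitInterval) {L : ℕ} {v₁ v₂ : Site d}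
    (h : Disjoint (sbox v₁ (4 * L)) (sbox v₂ (4 * L))) :
    (bondPercolation (zdGraph d) p).real (sCross L v₁ ∩ sCross L v₂) =
      (bondPercolation (zdGraph d) p).real (sCross L v₁) *
        (bondPercolation (zdGraph d) p).real (sCross L v₂) :=
  bondPercolation_real_inter_of_disjoint (zdGraph d) p (disjoint_edgeSet_withinGraph h)
    (determinedBy_sCross L v₁) (determinedBy_sCross L v₂) (measurableSet_sCross L v₁)
    (measurableSet_sCross L v₂)

/-- **The exit argument.** If a site `a ∈ Λ_v(L)` is joined by a path of open lattice edges to a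
site `b ∉ Λ_v(4L)`, then the translated crossing `sCross L v` occurs: the path leaves `Λ_v(4L)`
through a site of `∂ⁱⁿΛ_v(4L)`, reached from `a` inside `Λ_v(4L)`. -/
theorem mem_sCross_of_reachable {L : ℕ} {v a b : Site d} {ω : BondConfig (Site d)}
    (ha : a ∈ sbox v L) (hb : b ∉ sbox v (4 * L))
    (h : (openGraph ω ⊓ zdGraph d).Reachable a b) : ω ∈ sCross L v := by
  obtain ⟨W⟩ := h
  have ha' : a ∈ sbox v (4 * L) := sbox_mono v (by omega) ha
  obtain ⟨b', c', hb', hc', hadj, hr⟩ :=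
    exists_exit_of_walk (G := zdGraph d) (H := openGraph ω ⊓ zdGraph d) inf_le_right
      (sbox v (4 * L)) W ha' hb
  rw [sCross, mem_linked_iff]
  refine ⟨b', ?_, a, ha, ?_⟩
  · -- `b'` is a site of the translated inner boundary
    refine ⟨b' - v, ?_, by simp [zdShiftIso_apply]⟩
    rw [Finset.mem_coe, mem_innerBoundary_iff]
    have hbox : b' - v ∈ box d (4 * L) := by
      rw [mem_box]
      intro i
      simpa only [Pi.sub_apply] using (mem_sbox_iff.1 hb') i
    refine ⟨hbox, c' - v, fun hc => hc' ?_, ?_⟩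
    · rw [mem_sbox_iff]
      intro i
      simpa only [Pi.sub_apply] using (mem_box.1 hc) i
    · have hG : (zdGraph d).Adj b' c' := ((SimpleGraph.inf_adj _ _ _ _).1 hadj).2
      rw [← zdGraph_adj_shift_iff v, Site.shift_apply, Site.shift_apply, sub_add_cancel,
        sub_add_cancel]
      exact hG
  · -- the initial segment joins `b'` to `a` inside `Λ_v(4L)`
    rw [inConn_comm, mem_inConn_iff]
    exact hr.mono (inf_le_inf_right _ inf_le_left)

/-! ## The grid `(2L+1)ℤ^d` -/

/-- The grid point `(2L+1)k`. -/
def gridPt (L : ℕ) (k : Site d) : Site d := fun i => (2 * (L : ℤ) + 1) * k i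

/-- The index of the grid block containing `u`: `k_i = ⌊(u_i + L)/(2L+1)⌋`. -/
def gridIdx (L : ℕ) (u : Site d) : Site d := fun i => (u i + (L : ℤ)) / (2 * (L : ℤ) + 1)

/-- Every site lies in the block `Λ_{(2L+1)k}(L)` of its grid index `k`. -/
theorem mem_sbox_gridPt (L : ℕ) (u : Site d) : u ∈ sbox (gridPt L (gridIdx L u)) L := by
  rw [mem_sbox_iff]
  intro i
  simp only [gridPt, gridIdx]
  have hb : (0 : ℤ) < 2 * (L : ℤ) + 1 := by positivity
  have h1 := Int.mul_ediv_add_emod (u i + (L : ℤ)) (2 * (L : ℤ) + 1)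
  have h2 := Int.emod_nonneg (u i + (L : ℤ)) hb.ne'
  have h3 := Int.emod_lt_of_pos (u i + (L : ℤ)) hb
  constructor <;> linarith

/-- The grid index of a site of `Λ(M)` lies in `Λ(K)` as soon as `M + L < (K+1)(2L+1)`. -/
theorem gridIdx_mem_box {L M K : ℕ} (h₁ : (M : ℤ) + L < (K + 1) * (2 * (L : ℤ) + 1))
    {u : Site d} (hu : u ∈ box d M) : gridIdx L u ∈ box d K := by
  rw [mem_box] at hu ⊢
  intro i
  obtain ⟨hlo, hhi⟩ := hu i
  have hb : (0 : ℤ) < 2 * (L : ℤ) + 1 := by positivity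
  simp only [gridIdx]
  constructor
  · rw [Int.le_ediv_iff_mul_le hb]
    linarith
  · have hlt : (u i + (L : ℤ)) / (2 * (L : ℤ) + 1) < K + 1 := by
      rw [Int.ediv_lt_iff_lt_mul hb]
      linarith
    omega

/-- A coordinate of the grid point of a site of `Λ(M)` is at most `M + L` in absolute value,
and within `L` of the site. -/
theorem gridPt_gridIdx_sub_le (L : ℕ) (u : Site d) (i : Fin d) :
    -(L : ℤ) ≤ u i - gridPt L (gridIdx L u) i ∧ u i - gridPt L (gridIdx L u) i ≤ L :=
  (mem_sbox_iff.1 (mem_sbox_gridPt L u)) i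

end SurfaceTension

end Summit.CriticalPhenomena.PercolationContinuityZ3.Theorems

end
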